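import Summits.QuantumFields.BalabanUV.Beta.D1BFx.ChartDefectHeadRetabled

/-!
# `BalabanUV.Beta.D1BFx.ChartDefectHeadEndRetabled` — road «BF-x», binder row D1, RE-TABLE (`RETABLE-SPEC-g28.md` §4): **THE END ADAPTER RE-POINTED** — the (J1) binder `hC₁` of
# `RoadEndBFxCombS.d1Rep_BFx_comb_sbpS` VERBATIM (shape kept: `hC₁` from displayed rows), from the FIVE priced rows of `ChartDefectHeadRetabled` §2.

WHAT IT TYPES.  `hC₁` reads, for every `m ≥ 1`, `|secondMoment (c e z ↦ TshotOf Lc Jc m c e z − hessKer G₀(r) (vertexOfK G₀(r) (Lc^m) (S (Lc^m))) (vertex2OfK G₀(r) (Lc^m) (S₂ (Lc^m))) c e z) μ ν| ≤ CJ1`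
with `G₀(r) := coDressKBmAt (toSite (r (Lc^m))) (Lc^m) (KInvStep (Lc^m) 0)`, the block roots `r` PINNED by `hrpin : ∀ n, r n = ctrOff 4 n`, the literal's first-order
family `S` PINNED by `hSpin` to the odd-indexed RAW chart-(III′) member over an2's COMB record `combTablesAn1S2 n h (cΛ (Nat.log Lc n))` (R-D1-g55-1 (2); `RoadCombPinAn1`), and `Jc`, `S₂` the caller's.
HERE: `Jc := JcOfTabs hLc N (k ↦ symTablesAn1S2 3 (Lc^k) (cΛ k)) cΛ cB` (the literal, UNCHANGED), lockB `hcB : ∀ k, cB k = −(Lc^k)¹²∕4`, `S₂ (Lc^m) :=` the COMB pair table at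
`Lc^m` (`(Lc^m)⁸ • wilsonW₂ 3 ((8N²)⁻¹ • wsym22 N) + cB m • vh₂SAn1 (Lc^m)`), and the five rows (core)(rest)(mcol)(ms)(lamf) priced m-uniformly (HYPOTHESES, pins as in `ChartDefectHeadRetabled` §2) ⟹ `hC₁` with
`CJ1 := Ccore + Crest + Cmcol + Cms + Clamf` — `theorem hC1_of_retabled_rows`.  Plumbing only: `hrpin`, `dif_pos hLc.pow`, `Nat.log_pow`, `hcB`, then `abs_secondMoment_retabledDefect_scales_le_of_rows`.

HONEST DEPENDENCY (cell records, verbatim): «continuum YM on T⁴ ⇐ BetaPertH ∧ nine spine estimates (0/9 proved); BetaPertH ⇐ (D1) ∧ (D4) ∧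
CAP+tail; G-an2-4 gates asym, D1 and NE2/3/4.»  HONEST FRAMING (cell contract, verbatim): «discharging `BetaPertH` makes Bałaban's UV stability
UNCONDITIONAL — a real constructive-QFT result; it is NOT the continuum limit and NOT the Clay problem.»  THIS MODULE DISCHARGES NO binder of row D1 and
NO estimate of Bałaban's: [folklore] binder bookkeeping; the five rows are HYPOTHESES (none priced in the tree); colour data HYPOTHESES; no definition, no
`def … : Prop`, nothing cited, 0 sorry; one `set_option maxHeartbeats 800000 in` (statement elaboration of the scale-instantiated pins, as in `ChartDefectHeadRetabled` §2).
0∕4 row-D1 binders; (K) NOT closed; (J1) ONE OPEN ROW `hC₁` — HERE REDUCED TO FIVE DISPLAYED m-UNIFORM ROW PRICES AT THE RE-TABLED PIN, none in the tree (the (core) row's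
by-value n-law is the road's (B2′)-X); NOT D1, NEVER «G-an2-4 closed»,
NOT `BetaPertH`, NOT continuum, NOT Clay.

ABSOLUTE RULE (cell charter, verbatim): «No internally-minted statement may enter as a cited fact. Every hypothesis is either kernel-proved in this
package or a verbatim quotation of a PUBLISHED theorem with page reference. The manuscript(s) under audit are NOT citable for their own disputed
steps — they are the thing under adjudication; programme-internal (2001/route/tribunal) claims are never citable.»

Unit `b2b-balaban-beta-d1-p2` (road owner, gen 28), 2026-08-25; generator `g28/gen/mk_end_ret.py` (g26's `mk_end5.py` re-pointed); no existing file touched.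
-/

noncomputable section

namespace Summit.QuantumFields.BalabanUV.Beta.D1BFx.ChartDefectHeadEndRetabled

open Finset
open scoped BigOperators
open Literature.MathematicalPhysics.QuantumFieldTheory
open Literature.MathematicalPhysics.QuantumFieldTheory.Balaban1983to89
open Literature.MathematicalPhysics.QuantumFieldTheory.Balaban1983to89.Beta
open Literature.MathematicalPhysics.QuantumFieldTheory.Balaban1983to89.B12Beta (secondMoment)
open Literature.MathematicalPhysics.QuantumFieldTheory.Balaban1983to89.Beta.DecimatedMomentSummable (AbsMoment₂)
open ColourTrace (Complete TrOrthonormal)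
open WilsonVertex2Sym (wsym22)
open WilsonBiStencil (wilsonW₂)
open StepJetData (wilsonA)
open ExpKernelCalculus (MKer comp tr tadpole bubble hessKer)
open OneStepResolventKernel (Fib TOf)
open OneStepKernelFamily (colH vertexOfK KInvStep TshotOf)
open SecondOrderResponse (vertexOfM mixOfK W2SymOfK vertex2OfK)
open BalabanStepW2 (M2Of)
open AffineAveraging (Site toSite)
open AveragingContours (blk)
open AveragingContoursRooted (ctr ctrOff)
open Summit.QuantumFields.BalabanUV.Beta.BorderedHessian (diagK)
open Summit.QuantumFields.BalabanUV.Beta.DshAn1 (Dsh)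
open Summit.QuantumFields.BalabanUV.Beta.AxialDressingRooted (coDressKBmAt)
open Summit.QuantumFields.BalabanUV.Beta.AxialProjectorBlockMean (bmGaugeAt)
open Summit.QuantumFields.BalabanUV.Beta.AveragingWardRootedStencils (legSite)
open Summit.QuantumFields.BalabanUV.Beta.SymAveragingHessianCounts (symVhSAt symHessFFAt)
open Summit.QuantumFields.BalabanUV.Beta.SymSecondOrderTablesAn1 (symVh₂SAn1 symTablesAn1S2)
open Summit.QuantumFields.BalabanUV.Beta.CombTablesAn1 (combTablesAn1S2)
open Summit.QuantumFields.BalabanUV.Beta.SecondOrderSocketIdentification (vh₂SAn1)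
open Summit.QuantumFields.BalabanUV.Beta.CombChartStepJets (GcombSh JsB12CombSh0)
open Summit.QuantumFields.BalabanUV.Beta.CombChartJointEnd (JsB12CombShSym)
open Summit.QuantumFields.BalabanUV.Beta.CombOneShotJetsTabs (JcOfTabs)
open Summit.QuantumFields.BalabanUV.Beta.CompositeCorrectorLocality (blockSitesF)
open Summit.QuantumFields.BalabanUV.Beta.SymCorrectorFace (faceWt)
open Summit.QuantumFields.BalabanUV.Beta.D1BFx.ChartDefectHeadRetabled (abs_secondMoment_retabledDefect_scales_le_of_rows)

variable {Lc : ℕ} [NeZero Lc] {N : ℕ} {C : Type*} [Fintype C] [DecidableEq C] {τ : C → Matrix (Fin N) (Fin N) ℂ}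

set_option maxHeartbeats 800000 in
/-- **THE RE-TABLED (J1) BINDER `hC₁` FROM FIVE PRICED ROWS** [folklore binder bookkeeping].  For `Lc` odd, `2 ≤ Lc`, lockB (`hcB`), block roots `r`
pinned to `ctrOff` (`hrpin`) and the ROAD's first-order family `S` pinned to the odd-indexed raw chart-(III′) member over the COMB record (`hSpin` —
`RoadEndBFxCombS.d1Rep_BFx_comb_sbpS`'s binders VERBATIM with `Nlit := N`, `cΛlit := cΛ`, `cBlit := cB`): if the five row kernels of `ChartDefectHeadRetabled` §2 are priced
with m-INDEPENDENT constants, then for every `m ≥ 1` the re-tabled (J1) row holds with `CJ1 := Ccore + Crest + Cmcol + Cms + Clamf` — at the literal `Jc := JcOfTabs hLc N (k ↦ symTablesAn1S2 3 (Lc^k) (cΛ k)) cΛ cB`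
and the COMB pair table at `Lc^m`.  Proof: `hrpin`, `dif_pos hLc.pow`, `Nat.log_pow`, `hcB`, §2.  No row is priced here. -/
theorem hC1_of_retabled_rows (hLc : Odd Lc) (hL : 2 ≤ Lc) (hτ : Complete τ) (ho : TrOrthonormal τ) (hN : N ≠ 0) (c : C) (cΛ cB : ℕ → ℝ)
    (hcB : ∀ k : ℕ, cB k = -(((Lc ^ k : ℕ) : ℝ) ^ 12 / 4)) (μ ν : Fin 4)
    -- the END's per-scale block roots and first-order family, PINNED as in `RoadEndBFxCombS.d1Rep_BFx_comb_sbpS`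
    (r : ℕ → Fin 4 → ℕ) (hrpin : ∀ n : ℕ, r n = ctrOff 4 n)
    (S : ℕ → Fin 4 → (Fin 4 → ℤ) → MKer 4 (Fib 3))
    (hSpin : S = (fun n : ℕ => if h : Odd n then (haveI : NeZero n := ⟨h.pos.ne'⟩;
        (JsB12CombSh0 (Lc := n) h N (combTablesAn1S2 n h (cΛ (Nat.log Lc n))) (cΛ (Nat.log Lc n)) (cB (Nat.log Lc n)) 0).S) else 0))
    -- the five rows of `ChartDefectHeadRetabled` §2, per scale, with their pins
    (Wcore Wrest Wmcol Wms Wlamf : ℕ → Fin 4 → Fin 4 → Site 4 → ℝ)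
    (hWcore : ∀ (m : ℕ) (μ₀ ν₀ : Fin 4) (z₀ : Site 4), Wcore m μ₀ ν₀ z₀
      = (((-((1 / 2) * tr (comp (comp (comp (coDressKBmAt (ctr 4 (Lc ^ m)) (Lc ^ m) (KInvStep (d := 3) (Lc ^ m) 0)) (Dsh (Lc ^ m))) (GcombSh (d := 3) (Lc ^ m) 0)) (W2SymOfK (KInvStep (d := 3) (Lc ^ m) 0) (Lc ^ m) (fun κ u => (((Lc ^ m : ℕ) : ℝ) ^ 4) • wilsonA 3 κ u + (-(((Lc ^ m : ℕ) : ℝ) ^ 8 / 2)) • symVhSAt (ctr 4 (Lc ^ m)) 3 (Lc ^ m) rfl κ u)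
              ((symTablesAn1S2 3 (Lc ^ m) (cΛ m)).M 0) (fun κ u κ' u' => (((Lc ^ m : ℕ) : ℝ) ^ 8) • wilsonW₂ 3 ((8 * (N : ℝ) ^ 2)⁻¹ • wsym22 N) κ u κ' u' + (-(((Lc ^ m : ℕ) : ℝ) ^ 12 / 4)) • symVh₂SAn1 3 (Lc ^ m) κ u κ' u')
              (M2Of 3 (Lc ^ m) (symTablesAn1S2 3 (Lc ^ m) (cΛ m)).mixFF 0) μ₀ 0 ν₀ z₀
          + ((((comp (diagK fun z' b => ((Lc ^ m : ℕ) : ℝ) ^ 4 / 2 * bmGaugeAt (ctr 4 (Lc ^ m)) (colH (KInvStep (d := 3) (Lc ^ m) 0) (Lc ^ m) ν₀ z₀) (Lc ^ m) (legSite (ctr 4 (Lc ^ m)) z' b)) (vertexOfK (KInvStep (d := 3) (Lc ^ m) 0) (Lc ^ m) (fun κ u => (((Lc ^ m : ℕ) : ℝ) ^ 4) • wilsonA 3 κ u + (-(((Lc ^ m : ℕ) : ℝ) ^ 8 / 2)) • symVhSAt (ctr 4 (Lc ^ m)) 3 (Lc ^ m) rfl κ u) μ₀ 0)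
                - comp (vertexOfK (KInvStep (d := 3) (Lc ^ m) 0) (Lc ^ m) (fun κ u => (((Lc ^ m : ℕ) : ℝ) ^ 4) • wilsonA 3 κ u + (-(((Lc ^ m : ℕ) : ℝ) ^ 8 / 2)) • symVhSAt (ctr 4 (Lc ^ m)) 3 (Lc ^ m) rfl κ u) μ₀ 0) (diagK fun z' b => ((Lc ^ m : ℕ) : ℝ) ^ 4 / 2 * bmGaugeAt (ctr 4 (Lc ^ m)) (colH (KInvStep (d := 3) (Lc ^ m) 0) (Lc ^ m) ν₀ z₀) (Lc ^ m) (legSite (ctr 4 (Lc ^ m)) z' b)))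
              + (comp (diagK fun z' b => ((Lc ^ m : ℕ) : ℝ) ^ 4 / 2 * bmGaugeAt (ctr 4 (Lc ^ m)) (colH (KInvStep (d := 3) (Lc ^ m) 0) (Lc ^ m) μ₀ 0) (Lc ^ m) (legSite (ctr 4 (Lc ^ m)) z' b)) (vertexOfK (KInvStep (d := 3) (Lc ^ m) 0) (Lc ^ m) (fun κ u => (((Lc ^ m : ℕ) : ℝ) ^ 4) • wilsonA 3 κ u + (-(((Lc ^ m : ℕ) : ℝ) ^ 8 / 2)) • symVhSAt (ctr 4 (Lc ^ m)) 3 (Lc ^ m) rfl κ u) ν₀ z₀)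
                - comp (vertexOfK (KInvStep (d := 3) (Lc ^ m) 0) (Lc ^ m) (fun κ u => (((Lc ^ m : ℕ) : ℝ) ^ 4) • wilsonA 3 κ u + (-(((Lc ^ m : ℕ) : ℝ) ^ 8 / 2)) • symVhSAt (ctr 4 (Lc ^ m)) 3 (Lc ^ m) rfl κ u) ν₀ z₀) (diagK fun z' b => ((Lc ^ m : ℕ) : ℝ) ^ 4 / 2 * bmGaugeAt (ctr 4 (Lc ^ m)) (colH (KInvStep (d := 3) (Lc ^ m) 0) (Lc ^ m) μ₀ 0) (Lc ^ m) (legSite (ctr 4 (Lc ^ m)) z' b)))))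
            - (((comp (diagK fun z' b => ((Lc ^ m : ℕ) : ℝ) ^ 4 / 2 * bmGaugeAt (ctr 4 (Lc ^ m)) (colH (KInvStep (d := 3) (Lc ^ m) 0) (Lc ^ m) ν₀ z₀) (Lc ^ m) (legSite (ctr 4 (Lc ^ m)) z' b)) (vertexOfK (KInvStep (d := 3) (Lc ^ m) 0) (Lc ^ m) (JsB12CombSh0 (Lc := Lc ^ m) hLc.pow N (symTablesAn1S2 3 (Lc ^ m) (cΛ m)) (cΛ m) (-(((Lc ^ m : ℕ) : ℝ) ^ 12 / 4)) 0).S μ₀ 0)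
                - comp (vertexOfK (KInvStep (d := 3) (Lc ^ m) 0) (Lc ^ m) (JsB12CombSh0 (Lc := Lc ^ m) hLc.pow N (symTablesAn1S2 3 (Lc ^ m) (cΛ m)) (cΛ m) (-(((Lc ^ m : ℕ) : ℝ) ^ 12 / 4)) 0).S μ₀ 0) (diagK fun z' b => ((Lc ^ m : ℕ) : ℝ) ^ 4 / 2 * bmGaugeAt (ctr 4 (Lc ^ m)) (colH (KInvStep (d := 3) (Lc ^ m) 0) (Lc ^ m) ν₀ z₀) (Lc ^ m) (legSite (ctr 4 (Lc ^ m)) z' b)))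
              + (comp (diagK fun z' b => ((Lc ^ m : ℕ) : ℝ) ^ 4 / 2 * bmGaugeAt (ctr 4 (Lc ^ m)) (colH (KInvStep (d := 3) (Lc ^ m) 0) (Lc ^ m) μ₀ 0) (Lc ^ m) (legSite (ctr 4 (Lc ^ m)) z' b)) (vertexOfK (KInvStep (d := 3) (Lc ^ m) 0) (Lc ^ m) (JsB12CombSh0 (Lc := Lc ^ m) hLc.pow N (symTablesAn1S2 3 (Lc ^ m) (cΛ m)) (cΛ m) (-(((Lc ^ m : ℕ) : ℝ) ^ 12 / 4)) 0).S ν₀ z₀)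
                - comp (vertexOfK (KInvStep (d := 3) (Lc ^ m) 0) (Lc ^ m) (JsB12CombSh0 (Lc := Lc ^ m) hLc.pow N (symTablesAn1S2 3 (Lc ^ m) (cΛ m)) (cΛ m) (-(((Lc ^ m : ℕ) : ℝ) ^ 12 / 4)) 0).S ν₀ z₀) (diagK fun z' b => ((Lc ^ m : ℕ) : ℝ) ^ 4 / 2 * bmGaugeAt (ctr 4 (Lc ^ m)) (colH (KInvStep (d := 3) (Lc ^ m) 0) (Lc ^ m) μ₀ 0) (Lc ^ m) (legSite (ctr 4 (Lc ^ m)) z' b))))))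
          + ((mixOfK (coDressKBmAt (ctr 4 (Lc ^ m)) (Lc ^ m) (KInvStep (d := 3) (Lc ^ m) 0)) (Lc ^ m) (M2Of 3 (Lc ^ m) (symTablesAn1S2 3 (Lc ^ m) (cΛ m)).mixFF 0) μ₀ 0 ν₀ z₀
                - mixOfK (KInvStep (d := 3) (Lc ^ m) 0) (Lc ^ m) (M2Of 3 (Lc ^ m) (symTablesAn1S2 3 (Lc ^ m) (cΛ m)).mixFF 0) μ₀ 0 ν₀ z₀)
            + (mixOfK (coDressKBmAt (ctr 4 (Lc ^ m)) (Lc ^ m) (KInvStep (d := 3) (Lc ^ m) 0)) (Lc ^ m) (M2Of 3 (Lc ^ m) (symTablesAn1S2 3 (Lc ^ m) (cΛ m)).mixFF 0) ν₀ z₀ μ₀ 0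
                - mixOfK (KInvStep (d := 3) (Lc ^ m) 0) (Lc ^ m) (M2Of 3 (Lc ^ m) (symTablesAn1S2 3 (Lc ^ m) (cΛ m)).mixFF 0) ν₀ z₀ μ₀ 0))
          + (((mixOfK (coDressKBmAt (ctr 4 (Lc ^ m)) (Lc ^ m) (KInvStep (d := 3) (Lc ^ m) 0)) (Lc ^ m) (fun κ u ρ w => (if blk (Lc ^ m) (((Lc ^ m : ℕ) : ℤ) • w + (ctr 4 (Lc ^ m))) = blk (Lc ^ m) u then 2 * faceWt (ctrOff 4 (Lc ^ m)) (Lc ^ m) κ u else 0) • (symHessFFAt (ctr 4 (Lc ^ m)) (Lc ^ m)) ρ w) μ₀ 0 ν₀ z₀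
                + mixOfK (coDressKBmAt (ctr 4 (Lc ^ m)) (Lc ^ m) (KInvStep (d := 3) (Lc ^ m) 0)) (Lc ^ m) (fun κ u ρ w => (if blk (Lc ^ m) (((Lc ^ m : ℕ) : ℤ) • w + (ctr 4 (Lc ^ m))) = blk (Lc ^ m) u then 2 * faceWt (ctrOff 4 (Lc ^ m)) (Lc ^ m) κ u else 0) • (symHessFFAt (ctr 4 (Lc ^ m)) (Lc ^ m)) ρ w) ν₀ z₀ μ₀ 0)
              - (comp (diagK fun z b => ∑ α : Fin (3 + 1), ∑ x ∈ blockSitesF (Lc ^ m) (blk (Lc ^ m) (legSite (ctr 4 (Lc ^ m)) z b)), colH (coDressKBmAt (ctr 4 (Lc ^ m)) (Lc ^ m) (KInvStep (d := 3) (Lc ^ m) 0)) (Lc ^ m) μ₀ 0 α x * (2 * faceWt (ctrOff 4 (Lc ^ m)) (Lc ^ m) α x)) (vertexOfM (coDressKBmAt (ctr 4 (Lc ^ m)) (Lc ^ m) (KInvStep (d := 3) (Lc ^ m) 0)) (Lc ^ m) (symHessFFAt (ctr 4 (Lc ^ m)) (Lc ^ m)) ν₀ z₀)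
                + comp (diagK fun z b => ∑ α : Fin (3 + 1), ∑ x ∈ blockSitesF (Lc ^ m) (blk (Lc ^ m) (legSite (ctr 4 (Lc ^ m)) z b)), colH (coDressKBmAt (ctr 4 (Lc ^ m)) (Lc ^ m) (KInvStep (d := 3) (Lc ^ m) 0)) (Lc ^ m) ν₀ z₀ α x * (2 * faceWt (ctrOff 4 (Lc ^ m)) (Lc ^ m) α x)) (vertexOfM (coDressKBmAt (ctr 4 (Lc ^ m)) (Lc ^ m) (KInvStep (d := 3) (Lc ^ m) 0)) (Lc ^ m) (symHessFFAt (ctr 4 (Lc ^ m)) (Lc ^ m)) μ₀ 0)))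
          + ((((comp (diagK fun z b => -(∑ α : Fin (3 + 1), ∑ x ∈ blockSitesF (Lc ^ m) (blk (Lc ^ m) (legSite (ctr 4 (Lc ^ m)) z b)), colH (coDressKBmAt (ctr 4 (Lc ^ m)) (Lc ^ m) (KInvStep (d := 3) (Lc ^ m) 0)) (Lc ^ m) ν₀ z₀ α x * ((((Lc ^ m : ℕ) : ℝ) ^ 4 / 2) * faceWt (ctrOff 4 (Lc ^ m)) (Lc ^ m) α x))) (vertexOfK (coDressKBmAt (ctr 4 (Lc ^ m)) (Lc ^ m) (KInvStep (d := 3) (Lc ^ m) 0)) (Lc ^ m) (fun κ u => (((Lc ^ m : ℕ) : ℝ) ^ 4) • wilsonA 3 κ u + (-(((Lc ^ m : ℕ) : ℝ) ^ 8 / 2)) • symVhSAt (ctr 4 (Lc ^ m)) 3 (Lc ^ m) rfl κ u) μ₀ 0)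
                - comp (vertexOfK (coDressKBmAt (ctr 4 (Lc ^ m)) (Lc ^ m) (KInvStep (d := 3) (Lc ^ m) 0)) (Lc ^ m) (fun κ u => (((Lc ^ m : ℕ) : ℝ) ^ 4) • wilsonA 3 κ u + (-(((Lc ^ m : ℕ) : ℝ) ^ 8 / 2)) • symVhSAt (ctr 4 (Lc ^ m)) 3 (Lc ^ m) rfl κ u) μ₀ 0) (diagK fun z b => -(∑ α : Fin (3 + 1), ∑ x ∈ blockSitesF (Lc ^ m) (blk (Lc ^ m) (legSite (ctr 4 (Lc ^ m)) z b)), colH (coDressKBmAt (ctr 4 (Lc ^ m)) (Lc ^ m) (KInvStep (d := 3) (Lc ^ m) 0)) (Lc ^ m) ν₀ z₀ α x * ((((Lc ^ m : ℕ) : ℝ) ^ 4 / 2) * faceWt (ctrOff 4 (Lc ^ m)) (Lc ^ m) α x))))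
              + (comp (diagK fun z b => -(∑ α : Fin (3 + 1), ∑ x ∈ blockSitesF (Lc ^ m) (blk (Lc ^ m) (legSite (ctr 4 (Lc ^ m)) z b)), colH (coDressKBmAt (ctr 4 (Lc ^ m)) (Lc ^ m) (KInvStep (d := 3) (Lc ^ m) 0)) (Lc ^ m) μ₀ 0 α x * ((((Lc ^ m : ℕ) : ℝ) ^ 4 / 2) * faceWt (ctrOff 4 (Lc ^ m)) (Lc ^ m) α x))) (vertexOfK (coDressKBmAt (ctr 4 (Lc ^ m)) (Lc ^ m) (KInvStep (d := 3) (Lc ^ m) 0)) (Lc ^ m) (fun κ u => (((Lc ^ m : ℕ) : ℝ) ^ 4) • wilsonA 3 κ u + (-(((Lc ^ m : ℕ) : ℝ) ^ 8 / 2)) • symVhSAt (ctr 4 (Lc ^ m)) 3 (Lc ^ m) rfl κ u) ν₀ z₀)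
                - comp (vertexOfK (coDressKBmAt (ctr 4 (Lc ^ m)) (Lc ^ m) (KInvStep (d := 3) (Lc ^ m) 0)) (Lc ^ m) (fun κ u => (((Lc ^ m : ℕ) : ℝ) ^ 4) • wilsonA 3 κ u + (-(((Lc ^ m : ℕ) : ℝ) ^ 8 / 2)) • symVhSAt (ctr 4 (Lc ^ m)) 3 (Lc ^ m) rfl κ u) ν₀ z₀) (diagK fun z b => -(∑ α : Fin (3 + 1), ∑ x ∈ blockSitesF (Lc ^ m) (blk (Lc ^ m) (legSite (ctr 4 (Lc ^ m)) z b)), colH (coDressKBmAt (ctr 4 (Lc ^ m)) (Lc ^ m) (KInvStep (d := 3) (Lc ^ m) 0)) (Lc ^ m) μ₀ 0 α x * ((((Lc ^ m : ℕ) : ℝ) ^ 4 / 2) * faceWt (ctrOff 4 (Lc ^ m)) (Lc ^ m) α x))))))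
            - (((comp (diagK fun z b => -(∑ α : Fin (3 + 1), ∑ x ∈ blockSitesF (Lc ^ m) (blk (Lc ^ m) (legSite (ctr 4 (Lc ^ m)) z b)), colH (coDressKBmAt (ctr 4 (Lc ^ m)) (Lc ^ m) (KInvStep (d := 3) (Lc ^ m) 0)) (Lc ^ m) ν₀ z₀ α x * ((((Lc ^ m : ℕ) : ℝ) ^ 4 / 2) * faceWt (ctrOff 4 (Lc ^ m)) (Lc ^ m) α x))) (vertexOfK (coDressKBmAt (ctr 4 (Lc ^ m)) (Lc ^ m) (KInvStep (d := 3) (Lc ^ m) 0)) (Lc ^ m) (JsB12CombSh0 (Lc := Lc ^ m) hLc.pow N (symTablesAn1S2 3 (Lc ^ m) (cΛ m)) (cΛ m) (-(((Lc ^ m : ℕ) : ℝ) ^ 12 / 4)) 0).S μ₀ 0)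
                - comp (vertexOfK (coDressKBmAt (ctr 4 (Lc ^ m)) (Lc ^ m) (KInvStep (d := 3) (Lc ^ m) 0)) (Lc ^ m) (JsB12CombSh0 (Lc := Lc ^ m) hLc.pow N (symTablesAn1S2 3 (Lc ^ m) (cΛ m)) (cΛ m) (-(((Lc ^ m : ℕ) : ℝ) ^ 12 / 4)) 0).S μ₀ 0) (diagK fun z b => -(∑ α : Fin (3 + 1), ∑ x ∈ blockSitesF (Lc ^ m) (blk (Lc ^ m) (legSite (ctr 4 (Lc ^ m)) z b)), colH (coDressKBmAt (ctr 4 (Lc ^ m)) (Lc ^ m) (KInvStep (d := 3) (Lc ^ m) 0)) (Lc ^ m) ν₀ z₀ α x * ((((Lc ^ m : ℕ) : ℝ) ^ 4 / 2) * faceWt (ctrOff 4 (Lc ^ m)) (Lc ^ m) α x))))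
              + (comp (diagK fun z b => -(∑ α : Fin (3 + 1), ∑ x ∈ blockSitesF (Lc ^ m) (blk (Lc ^ m) (legSite (ctr 4 (Lc ^ m)) z b)), colH (coDressKBmAt (ctr 4 (Lc ^ m)) (Lc ^ m) (KInvStep (d := 3) (Lc ^ m) 0)) (Lc ^ m) μ₀ 0 α x * ((((Lc ^ m : ℕ) : ℝ) ^ 4 / 2) * faceWt (ctrOff 4 (Lc ^ m)) (Lc ^ m) α x))) (vertexOfK (coDressKBmAt (ctr 4 (Lc ^ m)) (Lc ^ m) (KInvStep (d := 3) (Lc ^ m) 0)) (Lc ^ m) (JsB12CombSh0 (Lc := Lc ^ m) hLc.pow N (symTablesAn1S2 3 (Lc ^ m) (cΛ m)) (cΛ m) (-(((Lc ^ m : ℕ) : ℝ) ^ 12 / 4)) 0).S ν₀ z₀)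
                - comp (vertexOfK (coDressKBmAt (ctr 4 (Lc ^ m)) (Lc ^ m) (KInvStep (d := 3) (Lc ^ m) 0)) (Lc ^ m) (JsB12CombSh0 (Lc := Lc ^ m) hLc.pow N (symTablesAn1S2 3 (Lc ^ m) (cΛ m)) (cΛ m) (-(((Lc ^ m : ℕ) : ℝ) ^ 12 / 4)) 0).S ν₀ z₀) (diagK fun z b => -(∑ α : Fin (3 + 1), ∑ x ∈ blockSitesF (Lc ^ m) (blk (Lc ^ m) (legSite (ctr 4 (Lc ^ m)) z b)), colH (coDressKBmAt (ctr 4 (Lc ^ m)) (Lc ^ m) (KInvStep (d := 3) (Lc ^ m) 0)) (Lc ^ m) μ₀ 0 α x * ((((Lc ^ m : ℕ) : ℝ) ^ 4 / 2) * faceWt (ctrOff 4 (Lc ^ m)) (Lc ^ m) α x)))))))))))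
        + (1 / 2) * (tr (comp (comp (comp (comp (coDressKBmAt (ctr 4 (Lc ^ m)) (Lc ^ m) (KInvStep (d := 3) (Lc ^ m) 0)) (Dsh (Lc ^ m))) (GcombSh (d := 3) (Lc ^ m) 0)) (vertexOfK (KInvStep (d := 3) (Lc ^ m) 0) (Lc ^ m) (JsB12CombSh0 (Lc := Lc ^ m) hLc.pow N (symTablesAn1S2 3 (Lc ^ m) (cΛ m)) (cΛ m) (-(((Lc ^ m : ℕ) : ℝ) ^ 12 / 4)) 0).S μ₀ 0)) (comp (GcombSh (d := 3) (Lc ^ m) 0) (vertexOfK (KInvStep (d := 3) (Lc ^ m) 0) (Lc ^ m) (JsB12CombSh0 (Lc := Lc ^ m) hLc.pow N (symTablesAn1S2 3 (Lc ^ m) (cΛ m)) (cΛ m) (-(((Lc ^ m : ℕ) : ℝ) ^ 12 / 4)) 0).S ν₀ z₀)))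
          + tr (comp (comp (coDressKBmAt (ctr 4 (Lc ^ m)) (Lc ^ m) (KInvStep (d := 3) (Lc ^ m) 0)) (vertexOfK (KInvStep (d := 3) (Lc ^ m) 0) (Lc ^ m) (JsB12CombSh0 (Lc := Lc ^ m) hLc.pow N (symTablesAn1S2 3 (Lc ^ m) (cΛ m)) (cΛ m) (-(((Lc ^ m : ℕ) : ℝ) ^ 12 / 4)) 0).S μ₀ 0)) (comp (comp (comp (coDressKBmAt (ctr 4 (Lc ^ m)) (Lc ^ m) (KInvStep (d := 3) (Lc ^ m) 0)) (Dsh (Lc ^ m))) (GcombSh (d := 3) (Lc ^ m) 0)) (vertexOfK (KInvStep (d := 3) (Lc ^ m) 0) (Lc ^ m) (JsB12CombSh0 (Lc := Lc ^ m) hLc.pow N (symTablesAn1S2 3 (Lc ^ m) (cΛ m)) (cΛ m) (-(((Lc ^ m : ℕ) : ℝ) ^ 12 / 4)) 0).S ν₀ z₀))))))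
        + ((1 / 2) * tadpole (coDressKBmAt (ctr 4 (Lc ^ m)) (Lc ^ m) (KInvStep (d := 3) (Lc ^ m) 0)) (comp (diagK fun z' b => ((Lc ^ m : ℕ) : ℝ) ^ 4 / 2 * bmGaugeAt (ctr 4 (Lc ^ m)) (colH (KInvStep (d := 3) (Lc ^ m) 0) (Lc ^ m) ν₀ z₀) (Lc ^ m) (legSite (ctr 4 (Lc ^ m)) z' b))
                (comp (diagK fun z' b => ((Lc ^ m : ℕ) : ℝ) ^ 4 / 2 * bmGaugeAt (ctr 4 (Lc ^ m)) (colH (KInvStep (d := 3) (Lc ^ m) 0) (Lc ^ m) μ₀ 0) (Lc ^ m) (legSite (ctr 4 (Lc ^ m)) z' b)) (Dsh (Lc ^ m))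
              - comp (Dsh (Lc ^ m)) (diagK fun z' b => ((Lc ^ m : ℕ) : ℝ) ^ 4 / 2 * bmGaugeAt (ctr 4 (Lc ^ m)) (colH (KInvStep (d := 3) (Lc ^ m) 0) (Lc ^ m) μ₀ 0) (Lc ^ m) (legSite (ctr 4 (Lc ^ m)) z' b)))
              - comp (comp (diagK fun z' b => ((Lc ^ m : ℕ) : ℝ) ^ 4 / 2 * bmGaugeAt (ctr 4 (Lc ^ m)) (colH (KInvStep (d := 3) (Lc ^ m) 0) (Lc ^ m) μ₀ 0) (Lc ^ m) (legSite (ctr 4 (Lc ^ m)) z' b)) (Dsh (Lc ^ m))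
              - comp (Dsh (Lc ^ m)) (diagK fun z' b => ((Lc ^ m : ℕ) : ℝ) ^ 4 / 2 * bmGaugeAt (ctr 4 (Lc ^ m)) (colH (KInvStep (d := 3) (Lc ^ m) 0) (Lc ^ m) μ₀ 0) (Lc ^ m) (legSite (ctr 4 (Lc ^ m)) z' b)))
                (diagK fun z' b => ((Lc ^ m : ℕ) : ℝ) ^ 4 / 2 * bmGaugeAt (ctr 4 (Lc ^ m)) (colH (KInvStep (d := 3) (Lc ^ m) 0) (Lc ^ m) ν₀ z₀) (Lc ^ m) (legSite (ctr 4 (Lc ^ m)) z' b))))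
        + ((1 / 2) * (bubble (coDressKBmAt (ctr 4 (Lc ^ m)) (Lc ^ m) (KInvStep (d := 3) (Lc ^ m) 0)) (vertexOfK (KInvStep (d := 3) (Lc ^ m) 0) (Lc ^ m) (JsB12CombSh0 (Lc := Lc ^ m) hLc.pow N (symTablesAn1S2 3 (Lc ^ m) (cΛ m)) (cΛ m) (-(((Lc ^ m : ℕ) : ℝ) ^ 12 / 4)) 0).S μ₀ 0) (comp (diagK fun z' b => ((Lc ^ m : ℕ) : ℝ) ^ 4 / 2 * bmGaugeAt (ctr 4 (Lc ^ m)) (colH (KInvStep (d := 3) (Lc ^ m) 0) (Lc ^ m) ν₀ z₀) (Lc ^ m) (legSite (ctr 4 (Lc ^ m)) z' b)) (Dsh (Lc ^ m))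
              - comp (Dsh (Lc ^ m)) (diagK fun z' b => ((Lc ^ m : ℕ) : ℝ) ^ 4 / 2 * bmGaugeAt (ctr 4 (Lc ^ m)) (colH (KInvStep (d := 3) (Lc ^ m) 0) (Lc ^ m) ν₀ z₀) (Lc ^ m) (legSite (ctr 4 (Lc ^ m)) z' b)))
            + bubble (coDressKBmAt (ctr 4 (Lc ^ m)) (Lc ^ m) (KInvStep (d := 3) (Lc ^ m) 0)) (comp (diagK fun z' b => ((Lc ^ m : ℕ) : ℝ) ^ 4 / 2 * bmGaugeAt (ctr 4 (Lc ^ m)) (colH (KInvStep (d := 3) (Lc ^ m) 0) (Lc ^ m) μ₀ 0) (Lc ^ m) (legSite (ctr 4 (Lc ^ m)) z' b)) (Dsh (Lc ^ m))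
              - comp (Dsh (Lc ^ m)) (diagK fun z' b => ((Lc ^ m : ℕ) : ℝ) ^ 4 / 2 * bmGaugeAt (ctr 4 (Lc ^ m)) (colH (KInvStep (d := 3) (Lc ^ m) 0) (Lc ^ m) μ₀ 0) (Lc ^ m) (legSite (ctr 4 (Lc ^ m)) z' b))) (vertexOfK (KInvStep (d := 3) (Lc ^ m) 0) (Lc ^ m) (JsB12CombSh0 (Lc := Lc ^ m) hLc.pow N (symTablesAn1S2 3 (Lc ^ m) (cΛ m)) (cΛ m) (-(((Lc ^ m : ℕ) : ℝ) ^ 12 / 4)) 0).S ν₀ z₀)))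
        + ((1 / 2) * bubble (coDressKBmAt (ctr 4 (Lc ^ m)) (Lc ^ m) (KInvStep (d := 3) (Lc ^ m) 0)) (comp (diagK fun z' b => ((Lc ^ m : ℕ) : ℝ) ^ 4 / 2 * bmGaugeAt (ctr 4 (Lc ^ m)) (colH (KInvStep (d := 3) (Lc ^ m) 0) (Lc ^ m) μ₀ 0) (Lc ^ m) (legSite (ctr 4 (Lc ^ m)) z' b)) (Dsh (Lc ^ m))
              - comp (Dsh (Lc ^ m)) (diagK fun z' b => ((Lc ^ m : ℕ) : ℝ) ^ 4 / 2 * bmGaugeAt (ctr 4 (Lc ^ m)) (colH (KInvStep (d := 3) (Lc ^ m) 0) (Lc ^ m) μ₀ 0) (Lc ^ m) (legSite (ctr 4 (Lc ^ m)) z' b))) (comp (diagK fun z' b => ((Lc ^ m : ℕ) : ℝ) ^ 4 / 2 * bmGaugeAt (ctr 4 (Lc ^ m)) (colH (KInvStep (d := 3) (Lc ^ m) 0) (Lc ^ m) ν₀ z₀) (Lc ^ m) (legSite (ctr 4 (Lc ^ m)) z' b)) (Dsh (Lc ^ m))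
              - comp (Dsh (Lc ^ m)) (diagK fun z' b => ((Lc ^ m : ℕ) : ℝ) ^ 4 / 2 * bmGaugeAt (ctr 4 (Lc ^ m)) (colH (KInvStep (d := 3) (Lc ^ m) 0) (Lc ^ m) ν₀ z₀) (Lc ^ m) (legSite (ctr 4 (Lc ^ m)) z' b)))))
        + ((1 / 2) * tadpole (coDressKBmAt (ctr 4 (Lc ^ m)) (Lc ^ m) (KInvStep (d := 3) (Lc ^ m) 0))
            (vertex2OfK (coDressKBmAt (ctr 4 (Lc ^ m)) (Lc ^ m) (KInvStep (d := 3) (Lc ^ m) 0)) (Lc ^ m)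
                (fun κ u κ' u' => (((Lc ^ m : ℕ) : ℝ) ^ 8) • wilsonW₂ 3 ((8 * (N : ℝ) ^ 2)⁻¹ • wsym22 N) κ u κ' u' + (-(((Lc ^ m : ℕ) : ℝ) ^ 12 / 4)) • symVh₂SAn1 3 (Lc ^ m) κ u κ' u') μ₀ 0 ν₀ z₀
              - vertex2OfK (coDressKBmAt (ctr 4 (Lc ^ m)) (Lc ^ m) (KInvStep (d := 3) (Lc ^ m) 0)) (Lc ^ m)
                (fun κ u κ' u' => (((Lc ^ m : ℕ) : ℝ) ^ 8) • wilsonW₂ 3 ((8 * (N : ℝ) ^ 2)⁻¹ • wsym22 N) κ u κ' u' + (-(((Lc ^ m : ℕ) : ℝ) ^ 12 / 4)) • vh₂SAn1 (Lc ^ m) κ u κ' u') μ₀ 0 ν₀ z₀)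
        - (1 / 2) * (bubble (coDressKBmAt (ctr 4 (Lc ^ m)) (Lc ^ m) (KInvStep (d := 3) (Lc ^ m) 0))
                (vertexOfK (coDressKBmAt (ctr 4 (Lc ^ m)) (Lc ^ m) (KInvStep (d := 3) (Lc ^ m) 0)) (Lc ^ m) (JsB12CombSh0 (Lc := Lc ^ m) hLc.pow N (combTablesAn1S2 (Lc ^ m) hLc.pow (cΛ m)) (cΛ m) (-(((Lc ^ m : ℕ) : ℝ) ^ 12 / 4)) 0).S μ₀ 0)
                (vertexOfK (coDressKBmAt (ctr 4 (Lc ^ m)) (Lc ^ m) (KInvStep (d := 3) (Lc ^ m) 0)) (Lc ^ m) (JsB12CombSh0 (Lc := Lc ^ m) hLc.pow N (symTablesAn1S2 3 (Lc ^ m) (cΛ m)) (cΛ m) (-(((Lc ^ m : ℕ) : ℝ) ^ 12 / 4)) 0).S ν₀ z₀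
                  - vertexOfK (coDressKBmAt (ctr 4 (Lc ^ m)) (Lc ^ m) (KInvStep (d := 3) (Lc ^ m) 0)) (Lc ^ m) (JsB12CombSh0 (Lc := Lc ^ m) hLc.pow N (combTablesAn1S2 (Lc ^ m) hLc.pow (cΛ m)) (cΛ m) (-(((Lc ^ m : ℕ) : ℝ) ^ 12 / 4)) 0).S ν₀ z₀)
            + bubble (coDressKBmAt (ctr 4 (Lc ^ m)) (Lc ^ m) (KInvStep (d := 3) (Lc ^ m) 0))
                (vertexOfK (coDressKBmAt (ctr 4 (Lc ^ m)) (Lc ^ m) (KInvStep (d := 3) (Lc ^ m) 0)) (Lc ^ m) (JsB12CombSh0 (Lc := Lc ^ m) hLc.pow N (symTablesAn1S2 3 (Lc ^ m) (cΛ m)) (cΛ m) (-(((Lc ^ m : ℕ) : ℝ) ^ 12 / 4)) 0).S μ₀ 0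
                  - vertexOfK (coDressKBmAt (ctr 4 (Lc ^ m)) (Lc ^ m) (KInvStep (d := 3) (Lc ^ m) 0)) (Lc ^ m) (JsB12CombSh0 (Lc := Lc ^ m) hLc.pow N (combTablesAn1S2 (Lc ^ m) hLc.pow (cΛ m)) (cΛ m) (-(((Lc ^ m : ℕ) : ℝ) ^ 12 / 4)) 0).S μ₀ 0)
                (vertexOfK (coDressKBmAt (ctr 4 (Lc ^ m)) (Lc ^ m) (KInvStep (d := 3) (Lc ^ m) 0)) (Lc ^ m) (JsB12CombSh0 (Lc := Lc ^ m) hLc.pow N (combTablesAn1S2 (Lc ^ m) hLc.pow (cΛ m)) (cΛ m) (-(((Lc ^ m : ℕ) : ℝ) ^ 12 / 4)) 0).S ν₀ z₀))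
        - (1 / 2) * bubble (coDressKBmAt (ctr 4 (Lc ^ m)) (Lc ^ m) (KInvStep (d := 3) (Lc ^ m) 0))
            (vertexOfK (coDressKBmAt (ctr 4 (Lc ^ m)) (Lc ^ m) (KInvStep (d := 3) (Lc ^ m) 0)) (Lc ^ m) (JsB12CombSh0 (Lc := Lc ^ m) hLc.pow N (symTablesAn1S2 3 (Lc ^ m) (cΛ m)) (cΛ m) (-(((Lc ^ m : ℕ) : ℝ) ^ 12 / 4)) 0).S μ₀ 0
              - vertexOfK (coDressKBmAt (ctr 4 (Lc ^ m)) (Lc ^ m) (KInvStep (d := 3) (Lc ^ m) 0)) (Lc ^ m) (JsB12CombSh0 (Lc := Lc ^ m) hLc.pow N (combTablesAn1S2 (Lc ^ m) hLc.pow (cΛ m)) (cΛ m) (-(((Lc ^ m : ℕ) : ℝ) ^ 12 / 4)) 0).S μ₀ 0)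
            (vertexOfK (coDressKBmAt (ctr 4 (Lc ^ m)) (Lc ^ m) (KInvStep (d := 3) (Lc ^ m) 0)) (Lc ^ m) (JsB12CombSh0 (Lc := Lc ^ m) hLc.pow N (symTablesAn1S2 3 (Lc ^ m) (cΛ m)) (cΛ m) (-(((Lc ^ m : ℕ) : ℝ) ^ 12 / 4)) 0).S ν₀ z₀
              - vertexOfK (coDressKBmAt (ctr 4 (Lc ^ m)) (Lc ^ m) (KInvStep (d := 3) (Lc ^ m) 0)) (Lc ^ m) (JsB12CombSh0 (Lc := Lc ^ m) hLc.pow N (combTablesAn1S2 (Lc ^ m) hLc.pow (cΛ m)) (cΛ m) (-(((Lc ^ m : ℕ) : ℝ) ^ 12 / 4)) 0).S ν₀ z₀)))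
    (hWrest : ∀ (m : ℕ) (μ₀ ν₀ : Fin 4) (z₀ : Site 4), Wrest m μ₀ ν₀ z₀
      = (1 / 2) * tadpole (coDressKBmAt (ctr 4 (Lc ^ m)) (Lc ^ m) (KInvStep (d := 3) (Lc ^ m) 0)) (W2SymOfK (KInvStep (d := 3) (Lc ^ m) 0) (Lc ^ m) (fun κ u => (((Lc ^ m : ℕ) : ℝ) ^ 4) • wilsonA 3 κ u + (-(((Lc ^ m : ℕ) : ℝ) ^ 8 / 2)) • symVhSAt (ctr 4 (Lc ^ m)) 3 (Lc ^ m) rfl κ u)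
              ((symTablesAn1S2 3 (Lc ^ m) (cΛ m)).M 0) (fun κ u κ' u' => (((Lc ^ m : ℕ) : ℝ) ^ 8) • wilsonW₂ 3 ((8 * (N : ℝ) ^ 2)⁻¹ • wsym22 N) κ u κ' u' + (-(((Lc ^ m : ℕ) : ℝ) ^ 12 / 4)) • symVh₂SAn1 3 (Lc ^ m) κ u κ' u')
              (M2Of 3 (Lc ^ m) (symTablesAn1S2 3 (Lc ^ m) (cΛ m)).mixFF 0) μ₀ 0 ν₀ z₀
            - vertex2OfK (KInvStep (d := 3) (Lc ^ m) 0) (Lc ^ m)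
              (fun κ u κ' u' => (((Lc ^ m : ℕ) : ℝ) ^ 8) • wilsonW₂ 3 ((8 * (N : ℝ) ^ 2)⁻¹ • wsym22 N) κ u κ' u' + (-(((Lc ^ m : ℕ) : ℝ) ^ 12 / 4)) • symVh₂SAn1 3 (Lc ^ m) κ u κ' u') μ₀ 0 ν₀ z₀))
    (hWmcol : ∀ (m : ℕ) (μ₀ ν₀ : Fin 4) (z₀ : Site 4), Wmcol m μ₀ ν₀ z₀
      = (1 / 2) * tadpole (coDressKBmAt (ctr 4 (Lc ^ m)) (Lc ^ m) (KInvStep (d := 3) (Lc ^ m) 0)) (((mixOfK (coDressKBmAt (ctr 4 (Lc ^ m)) (Lc ^ m) (KInvStep (d := 3) (Lc ^ m) 0)) (Lc ^ m) (M2Of 3 (Lc ^ m) (symTablesAn1S2 3 (Lc ^ m) (cΛ m)).mixFF 0) μ₀ 0 ν₀ z₀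
                - mixOfK (KInvStep (d := 3) (Lc ^ m) 0) (Lc ^ m) (M2Of 3 (Lc ^ m) (symTablesAn1S2 3 (Lc ^ m) (cΛ m)).mixFF 0) μ₀ 0 ν₀ z₀)
            + (mixOfK (coDressKBmAt (ctr 4 (Lc ^ m)) (Lc ^ m) (KInvStep (d := 3) (Lc ^ m) 0)) (Lc ^ m) (M2Of 3 (Lc ^ m) (symTablesAn1S2 3 (Lc ^ m) (cΛ m)).mixFF 0) ν₀ z₀ μ₀ 0
                - mixOfK (KInvStep (d := 3) (Lc ^ m) 0) (Lc ^ m) (M2Of 3 (Lc ^ m) (symTablesAn1S2 3 (Lc ^ m) (cΛ m)).mixFF 0) ν₀ z₀ μ₀ 0))))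
    (hWms : ∀ (m : ℕ) (μ₀ ν₀ : Fin 4) (z₀ : Site 4), Wms m μ₀ ν₀ z₀
      = (1 / 2) * tadpole (coDressKBmAt (ctr 4 (Lc ^ m)) (Lc ^ m) (KInvStep (d := 3) (Lc ^ m) 0)) (((mixOfK (coDressKBmAt (ctr 4 (Lc ^ m)) (Lc ^ m) (KInvStep (d := 3) (Lc ^ m) 0)) (Lc ^ m) (fun κ u ρ w => (if blk (Lc ^ m) (((Lc ^ m : ℕ) : ℤ) • w + (ctr 4 (Lc ^ m))) = blk (Lc ^ m) u then 2 * faceWt (ctrOff 4 (Lc ^ m)) (Lc ^ m) κ u else 0) • (symHessFFAt (ctr 4 (Lc ^ m)) (Lc ^ m)) ρ w) μ₀ 0 ν₀ z₀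
                + mixOfK (coDressKBmAt (ctr 4 (Lc ^ m)) (Lc ^ m) (KInvStep (d := 3) (Lc ^ m) 0)) (Lc ^ m) (fun κ u ρ w => (if blk (Lc ^ m) (((Lc ^ m : ℕ) : ℤ) • w + (ctr 4 (Lc ^ m))) = blk (Lc ^ m) u then 2 * faceWt (ctrOff 4 (Lc ^ m)) (Lc ^ m) κ u else 0) • (symHessFFAt (ctr 4 (Lc ^ m)) (Lc ^ m)) ρ w) ν₀ z₀ μ₀ 0)
              - (comp (diagK fun z b => ∑ α : Fin (3 + 1), ∑ x ∈ blockSitesF (Lc ^ m) (blk (Lc ^ m) (legSite (ctr 4 (Lc ^ m)) z b)), colH (coDressKBmAt (ctr 4 (Lc ^ m)) (Lc ^ m) (KInvStep (d := 3) (Lc ^ m) 0)) (Lc ^ m) μ₀ 0 α x * (2 * faceWt (ctrOff 4 (Lc ^ m)) (Lc ^ m) α x)) (vertexOfM (coDressKBmAt (ctr 4 (Lc ^ m)) (Lc ^ m) (KInvStep (d := 3) (Lc ^ m) 0)) (Lc ^ m) (symHessFFAt (ctr 4 (Lc ^ m)) (Lc ^ m)) ν₀ z₀)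
                + comp (diagK fun z b => ∑ α : Fin (3 + 1), ∑ x ∈ blockSitesF (Lc ^ m) (blk (Lc ^ m) (legSite (ctr 4 (Lc ^ m)) z b)), colH (coDressKBmAt (ctr 4 (Lc ^ m)) (Lc ^ m) (KInvStep (d := 3) (Lc ^ m) 0)) (Lc ^ m) ν₀ z₀ α x * (2 * faceWt (ctrOff 4 (Lc ^ m)) (Lc ^ m) α x)) (vertexOfM (coDressKBmAt (ctr 4 (Lc ^ m)) (Lc ^ m) (KInvStep (d := 3) (Lc ^ m) 0)) (Lc ^ m) (symHessFFAt (ctr 4 (Lc ^ m)) (Lc ^ m)) μ₀ 0)))))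
    (hWlamf : ∀ (m : ℕ) (μ₀ ν₀ : Fin 4) (z₀ : Site 4), Wlamf m μ₀ ν₀ z₀
      = (1 / 2) * tadpole (coDressKBmAt (ctr 4 (Lc ^ m)) (Lc ^ m) (KInvStep (d := 3) (Lc ^ m) 0)) ((((comp (diagK fun z b => -(∑ α : Fin (3 + 1), ∑ x ∈ blockSitesF (Lc ^ m) (blk (Lc ^ m) (legSite (ctr 4 (Lc ^ m)) z b)), colH (coDressKBmAt (ctr 4 (Lc ^ m)) (Lc ^ m) (KInvStep (d := 3) (Lc ^ m) 0)) (Lc ^ m) ν₀ z₀ α x * ((((Lc ^ m : ℕ) : ℝ) ^ 4 / 2) * faceWt (ctrOff 4 (Lc ^ m)) (Lc ^ m) α x))) (vertexOfK (coDressKBmAt (ctr 4 (Lc ^ m)) (Lc ^ m) (KInvStep (d := 3) (Lc ^ m) 0)) (Lc ^ m) (fun κ u => (((Lc ^ m : ℕ) : ℝ) ^ 4) • wilsonA 3 κ u + (-(((Lc ^ m : ℕ) : ℝ) ^ 8 / 2)) • symVhSAt (ctr 4 (Lc ^ m)) 3 (Lc ^ m) rfl κ u) μ₀ 0)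
                - comp (vertexOfK (coDressKBmAt (ctr 4 (Lc ^ m)) (Lc ^ m) (KInvStep (d := 3) (Lc ^ m) 0)) (Lc ^ m) (fun κ u => (((Lc ^ m : ℕ) : ℝ) ^ 4) • wilsonA 3 κ u + (-(((Lc ^ m : ℕ) : ℝ) ^ 8 / 2)) • symVhSAt (ctr 4 (Lc ^ m)) 3 (Lc ^ m) rfl κ u) μ₀ 0) (diagK fun z b => -(∑ α : Fin (3 + 1), ∑ x ∈ blockSitesF (Lc ^ m) (blk (Lc ^ m) (legSite (ctr 4 (Lc ^ m)) z b)), colH (coDressKBmAt (ctr 4 (Lc ^ m)) (Lc ^ m) (KInvStep (d := 3) (Lc ^ m) 0)) (Lc ^ m) ν₀ z₀ α x * ((((Lc ^ m : ℕ) : ℝ) ^ 4 / 2) * faceWt (ctrOff 4 (Lc ^ m)) (Lc ^ m) α x))))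
              + (comp (diagK fun z b => -(∑ α : Fin (3 + 1), ∑ x ∈ blockSitesF (Lc ^ m) (blk (Lc ^ m) (legSite (ctr 4 (Lc ^ m)) z b)), colH (coDressKBmAt (ctr 4 (Lc ^ m)) (Lc ^ m) (KInvStep (d := 3) (Lc ^ m) 0)) (Lc ^ m) μ₀ 0 α x * ((((Lc ^ m : ℕ) : ℝ) ^ 4 / 2) * faceWt (ctrOff 4 (Lc ^ m)) (Lc ^ m) α x))) (vertexOfK (coDressKBmAt (ctr 4 (Lc ^ m)) (Lc ^ m) (KInvStep (d := 3) (Lc ^ m) 0)) (Lc ^ m) (fun κ u => (((Lc ^ m : ℕ) : ℝ) ^ 4) • wilsonA 3 κ u + (-(((Lc ^ m : ℕ) : ℝ) ^ 8 / 2)) • symVhSAt (ctr 4 (Lc ^ m)) 3 (Lc ^ m) rfl κ u) ν₀ z₀)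
                - comp (vertexOfK (coDressKBmAt (ctr 4 (Lc ^ m)) (Lc ^ m) (KInvStep (d := 3) (Lc ^ m) 0)) (Lc ^ m) (fun κ u => (((Lc ^ m : ℕ) : ℝ) ^ 4) • wilsonA 3 κ u + (-(((Lc ^ m : ℕ) : ℝ) ^ 8 / 2)) • symVhSAt (ctr 4 (Lc ^ m)) 3 (Lc ^ m) rfl κ u) ν₀ z₀) (diagK fun z b => -(∑ α : Fin (3 + 1), ∑ x ∈ blockSitesF (Lc ^ m) (blk (Lc ^ m) (legSite (ctr 4 (Lc ^ m)) z b)), colH (coDressKBmAt (ctr 4 (Lc ^ m)) (Lc ^ m) (KInvStep (d := 3) (Lc ^ m) 0)) (Lc ^ m) μ₀ 0 α x * ((((Lc ^ m : ℕ) : ℝ) ^ 4 / 2) * faceWt (ctrOff 4 (Lc ^ m)) (Lc ^ m) α x))))))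
            - (((comp (diagK fun z b => -(∑ α : Fin (3 + 1), ∑ x ∈ blockSitesF (Lc ^ m) (blk (Lc ^ m) (legSite (ctr 4 (Lc ^ m)) z b)), colH (coDressKBmAt (ctr 4 (Lc ^ m)) (Lc ^ m) (KInvStep (d := 3) (Lc ^ m) 0)) (Lc ^ m) ν₀ z₀ α x * ((((Lc ^ m : ℕ) : ℝ) ^ 4 / 2) * faceWt (ctrOff 4 (Lc ^ m)) (Lc ^ m) α x))) (vertexOfK (coDressKBmAt (ctr 4 (Lc ^ m)) (Lc ^ m) (KInvStep (d := 3) (Lc ^ m) 0)) (Lc ^ m) (JsB12CombSh0 (Lc := Lc ^ m) hLc.pow N (symTablesAn1S2 3 (Lc ^ m) (cΛ m)) (cΛ m) (-(((Lc ^ m : ℕ) : ℝ) ^ 12 / 4)) 0).S μ₀ 0)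
                - comp (vertexOfK (coDressKBmAt (ctr 4 (Lc ^ m)) (Lc ^ m) (KInvStep (d := 3) (Lc ^ m) 0)) (Lc ^ m) (JsB12CombSh0 (Lc := Lc ^ m) hLc.pow N (symTablesAn1S2 3 (Lc ^ m) (cΛ m)) (cΛ m) (-(((Lc ^ m : ℕ) : ℝ) ^ 12 / 4)) 0).S μ₀ 0) (diagK fun z b => -(∑ α : Fin (3 + 1), ∑ x ∈ blockSitesF (Lc ^ m) (blk (Lc ^ m) (legSite (ctr 4 (Lc ^ m)) z b)), colH (coDressKBmAt (ctr 4 (Lc ^ m)) (Lc ^ m) (KInvStep (d := 3) (Lc ^ m) 0)) (Lc ^ m) ν₀ z₀ α x * ((((Lc ^ m : ℕ) : ℝ) ^ 4 / 2) * faceWt (ctrOff 4 (Lc ^ m)) (Lc ^ m) α x))))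
              + (comp (diagK fun z b => -(∑ α : Fin (3 + 1), ∑ x ∈ blockSitesF (Lc ^ m) (blk (Lc ^ m) (legSite (ctr 4 (Lc ^ m)) z b)), colH (coDressKBmAt (ctr 4 (Lc ^ m)) (Lc ^ m) (KInvStep (d := 3) (Lc ^ m) 0)) (Lc ^ m) μ₀ 0 α x * ((((Lc ^ m : ℕ) : ℝ) ^ 4 / 2) * faceWt (ctrOff 4 (Lc ^ m)) (Lc ^ m) α x))) (vertexOfK (coDressKBmAt (ctr 4 (Lc ^ m)) (Lc ^ m) (KInvStep (d := 3) (Lc ^ m) 0)) (Lc ^ m) (JsB12CombSh0 (Lc := Lc ^ m) hLc.pow N (symTablesAn1S2 3 (Lc ^ m) (cΛ m)) (cΛ m) (-(((Lc ^ m : ℕ) : ℝ) ^ 12 / 4)) 0).S ν₀ z₀)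
                - comp (vertexOfK (coDressKBmAt (ctr 4 (Lc ^ m)) (Lc ^ m) (KInvStep (d := 3) (Lc ^ m) 0)) (Lc ^ m) (JsB12CombSh0 (Lc := Lc ^ m) hLc.pow N (symTablesAn1S2 3 (Lc ^ m) (cΛ m)) (cΛ m) (-(((Lc ^ m : ℕ) : ℝ) ^ 12 / 4)) 0).S ν₀ z₀) (diagK fun z b => -(∑ α : Fin (3 + 1), ∑ x ∈ blockSitesF (Lc ^ m) (blk (Lc ^ m) (legSite (ctr 4 (Lc ^ m)) z b)), colH (coDressKBmAt (ctr 4 (Lc ^ m)) (Lc ^ m) (KInvStep (d := 3) (Lc ^ m) 0)) (Lc ^ m) μ₀ 0 α x * ((((Lc ^ m : ℕ) : ℝ) ^ 4 / 2) * faceWt (ctrOff 4 (Lc ^ m)) (Lc ^ m) α x))))))))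
    -- the m-INDEPENDENT prices (constants bound BEFORE `∀ m`)
    {Ccore Crest Cmcol Cms Clamf : ℝ}
    (hAcore : ∀ m a e, AbsMoment₂ (Wcore m a e)) (hBcore : ∀ m, |secondMoment (Wcore m) μ ν| ≤ Ccore)
    (hArest : ∀ m a e, AbsMoment₂ (Wrest m a e)) (hBrest : ∀ m, |secondMoment (Wrest m) μ ν| ≤ Crest)
    (hAmcol : ∀ m a e, AbsMoment₂ (Wmcol m a e)) (hBmcol : ∀ m, |secondMoment (Wmcol m) μ ν| ≤ Cmcol)
    (hAms : ∀ m a e, AbsMoment₂ (Wms m a e)) (hBms : ∀ m, |secondMoment (Wms m) μ ν| ≤ Cms)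
    (hAlamf : ∀ m a e, AbsMoment₂ (Wlamf m a e)) (hBlamf : ∀ m, |secondMoment (Wlamf m) μ ν| ≤ Clamf)
    :
    ∀ m : ℕ, 1 ≤ m → |secondMoment (fun (c e : Fin 4) (z : Site 4) =>
        TshotOf Lc (JcOfTabs hLc N (fun k => symTablesAn1S2 3 (Lc ^ k) (cΛ k)) cΛ cB) m c e z
          - hessKer (coDressKBmAt (toSite (r (Lc ^ m))) (Lc ^ m) (KInvStep (d := 3) (Lc ^ m) 0))
              (vertexOfK (coDressKBmAt (toSite (r (Lc ^ m))) (Lc ^ m) (KInvStep (d := 3) (Lc ^ m) 0)) (Lc ^ m) (S (Lc ^ m)))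
              (vertex2OfK (coDressKBmAt (toSite (r (Lc ^ m))) (Lc ^ m) (KInvStep (d := 3) (Lc ^ m) 0)) (Lc ^ m)
                (fun κ u κ' u' => (((Lc ^ m : ℕ) : ℝ) ^ 8) • wilsonW₂ 3 ((8 * (N : ℝ) ^ 2)⁻¹ • wsym22 N) κ u κ' u' + (-(((Lc ^ m : ℕ) : ℝ) ^ 12 / 4)) • vh₂SAn1 (Lc ^ m) κ u κ' u')) c e z) μ ν|
      ≤ Ccore + Crest + Cmcol + Cms + Clamf := by
  intro m _hm
  have hL1 : 1 < Lc := hL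
  have hr : r (Lc ^ m) = ctrOff 4 (Lc ^ m) := hrpin (Lc ^ m)
  have hcBm : cB = fun k => -(((Lc ^ k : ℕ) : ℝ) ^ 12 / 4) := funext hcB
  have hS : S (Lc ^ m) = (JsB12CombSh0 (Lc := Lc ^ m) hLc.pow N (combTablesAn1S2 (Lc ^ m) hLc.pow (cΛ m)) (cΛ m) (-(((Lc ^ m : ℕ) : ℝ) ^ 12 / 4)) 0).S := by
    subst hSpin
    simp only [dif_pos hLc.pow, Nat.log_pow hL1, hcB m]
  rw [hr, hS, hcBm]
  exact abs_secondMoment_retabledDefect_scales_le_of_rows hLc hτ ho hN c cΛ μ ν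
    Wcore Wrest Wmcol Wms Wlamf
    hWcore hWrest hWmcol hWms hWlamf
    hAcore hBcore hArest hBrest hAmcol hBmcol hAms hBms hAlamf hBlamf m

end Summit.QuantumFields.BalabanUV.Beta.D1BFx.ChartDefectHeadEndRetabled

end
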